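import Summits.Parity.BatemanHorn.Theorems.RoughValueTransportRoughValueLawSieveBand
import HarnessLib

/-!
# Route `RoughParitySectors`, crux `OddSectorShareLinear` (stmt-Parity-15629), line `birth`:
# helpers for the registered stubs `stub_sieveDecouplingOdd` / `stub_sieveDecouplingPrime`
# (S' : sieving the other members out of the rough values of `f_m` costs the sieve factor `W_m`)

`--supports stmt-Parity-15629` file.  Both halves S'a (prime cells) and S'b (odd cells) of the
sieve-decoupling step apply the tree's PROVED uniform Fundamental Lemma
(`SieveSequence.fundamental_lemma_uniform_holds`) in dimension `2S`, `S = Σ deg fᵢ`, with the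
CONDITIONAL density of the line's skeleton,

  `g_m(p) = #{c < p : p ∤ f_m(c), ∃ i ≠ m, p ∣ f_i(c)} / #{c < p : p ∤ f_m(c)}`,

whose partial products `W_m(z) = ∏_{p < z} (1 − g_m(p))` are the sieve factor of the stubs.  This
file records, once and for all, the sieve-theoretic standing of `g_m` (everything PROVED, no
definition, no new fact):

* `hasSieveDimension_of_apply_le` — the dimension condition `Ω(κ)` of `SieveFramework.lean` is
  monotone in the density: `0 ≤ g ≤ g'` at the primes and `Ω(κ), K` for `g'` give `Ω(κ), K` for `g`;
* `le_prod_one_sub_of_hasSieveDimension`, `prod_one_sub_pos_of_hasSieveDimension` — under `Ω(κ), K`: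
  `(log 2)^κ / (K (log z)^κ) ≤ ∏_{p<z} (1 − g(p))` for `z ≥ 2`, and positivity;
* `card_num_add_card_roots_le`, `card_den_add_card_roots_eq`, `num_subset_den` — the local counts:
  with `ω_f(p) = polyRootCountMod f p` and `ω_m(p) = #{c < p : p ∣ f_m(c)}`,
  `#num + ω_m(p) ≤ ω_f(p)`, `#den + ω_m(p) = p`, `num ⊆ den`;
* `condDensity_nonneg`, `condDensity_le_rootDensity`, `condDensity_lt_one`, `card_den_pos` — for a
  Bateman–Horn system: `0 ≤ g_m(p) ≤ ω_f(p)/p < 1` (uses `ω_f(p) < p`, no fixed prime divisor);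
* `hasSieveDimension_condDensity` — THE RESULT: every arithmetic function agreeing with `g_m` at the
  primes satisfies `Ω(2S)` with the constant `K_S = (2S+1)^{2S+1} e^{2S(9/2 + 6/log 2)}` of
  `BoundedClassDensity.hasSieveDimension_of_card_le` (`S = Σ deg fᵢ`);
* `sieveFactor_pos`, `exists_le_sieveFactor` — `W_m(z) > 0` and `W_m(z) ≥ c_S/(log z)^{2S}` (`z ≥ 2`).

References: H. Halberstam, H.-E. Richert, *Sieve Methods* (1974), Ch. 2 (`Ω₂(κ)`);
J. Friedlander, H. Iwaniec, *Opera de Cribro* (2010), (5.38), §5.5, Cor. 6.10.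
-/

noncomputable section

open Filter Finset Polynomial
open scoped BigOperators Topology ArithmeticFunction.Omega
open Literature.NumberTheory.Sieve

namespace Summit.Parity.BatemanHorn.Cruxes.OddSectorShareLinear.Birth

namespace SieveDecouplingOdd

/-! ### Monotonicity of the dimension condition and the lower bound for `V(z)` -/

/-- The sieve-dimension condition is monotone in the density: if `0 ≤ g(p) ≤ g'(p)` at every prime
and `g'` satisfies `Ω(κ)` with constant `K`, so does `g` (termwise
`(1 − g(p))⁻¹ ≤ (1 − g'(p))⁻¹`). [folklore] -/
theorem hasSieveDimension_of_apply_le {g g' : ArithmeticFunction ℝ} {κ K : ℝ}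
    (h : HasSieveDimension g' κ K) (hle : ∀ p : ℕ, p.Prime → 0 ≤ g p ∧ g p ≤ g' p) :
    HasSieveDimension g κ K := by
  refine ⟨fun p hp => ⟨(hle p hp).1, (hle p hp).2.trans_lt (h.1 p hp).2⟩, fun w z hw hwz => ?_⟩
  refine le_trans (Finset.prod_le_prod (fun p hp => ?_) (fun p hp => ?_)) (h.2 w z hw hwz)
  · have hpp := Nat.prime_of_mem_primesBelow (Finset.mem_filter.mp hp).1
    exact inv_nonneg.mpr (sub_nonneg.mpr ((hle p hpp).2.trans (h.1 p hpp).2.le))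
  · have hpp := Nat.prime_of_mem_primesBelow (Finset.mem_filter.mp hp).1
    exact inv_anti₀ (sub_pos.mpr (h.1 p hpp).2) (by linarith [(hle p hpp).2])

/-- Under `Ω(κ)` the partial products `∏_{p < M} (1 − g(p))` are positive. [folklore] -/
theorem prod_one_sub_pos_of_hasSieveDimension {g : ArithmeticFunction ℝ} {κ K : ℝ}
    (h : HasSieveDimension g κ K) (M : ℕ) : 0 < ∏ p ∈ Nat.primesBelow M, (1 - g p) :=
  Finset.prod_pos fun p hp => sub_pos.mpr (h.1 p (Nat.prime_of_mem_primesBelow hp)).2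

/-- **Lower bound for `V(z)` from the dimension condition** (the case `w = 2` of `Ω(κ)`):
`(log 2)^κ / (K (log z)^κ) ≤ ∏_{p < z} (1 − g(p))` for `z ≥ 2`. [folklore] -/
theorem le_prod_one_sub_of_hasSieveDimension {g : ArithmeticFunction ℝ} {κ K : ℝ}
    (h : HasSieveDimension g κ K) {z : ℝ} (hz : 2 ≤ z) :
    Real.log 2 ^ κ / (K * Real.log z ^ κ) ≤ ∏ p ∈ Nat.primesBelow ⌈z⌉₊, (1 - g p) := by
  have h2 := h.2 2 z le_rfl hz
  have hfilter : (Nat.primesBelow ⌈z⌉₊).filter (fun p : ℕ => (2 : ℝ) ≤ (p : ℝ)) =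
      Nat.primesBelow ⌈z⌉₊ :=
    Finset.filter_true_of_mem fun p hp => by
      exact_mod_cast (Nat.prime_of_mem_primesBelow hp).two_le
  rw [hfilter, Finset.prod_inv_distrib] at h2
  have hV := prod_one_sub_pos_of_hasSieveDimension h ⌈z⌉₊
  have hlog2 : 0 < Real.log 2 := Real.log_pos one_lt_two
  have hlogz : 0 < Real.log z := Real.log_pos (by linarith)
  have hK : 0 < K := lt_of_lt_of_le zero_lt_one h.one_le
  have h3 := inv_anti₀ (inv_pos.mpr hV) h2
  rw [inv_inv, Real.div_rpow hlogz.le hlog2.le] at h3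
  have h4 : Real.log 2 ^ κ / (K * Real.log z ^ κ) = (K * (Real.log z ^ κ / Real.log 2 ^ κ))⁻¹ := by
    have h5 : 0 < Real.log 2 ^ κ := Real.rpow_pos_of_pos hlog2 κ
    have h6 : 0 < Real.log z ^ κ := Real.rpow_pos_of_pos hlogz κ
    field_simp
  rw [h4]
  exact h3

/-! ### The local counts of the conditional density -/

variable {k : ℕ} {f : Fin k → ℤ[X]}

/-- `num ⊆ den`: the classes removed by the other members are among the classes where `p ∤ f_m`.
[folklore] -/
theorem num_subset_den (f : Fin k → ℤ[X]) (m : Fin k) (p : ℕ) :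
    (Finset.range p).filter (fun c : ℕ => ¬ ((p : ℤ) ∣ (f m).eval (c : ℤ)) ∧ ∃ i, i ≠ m ∧ (p : ℤ)
      ∣ (f i).eval (c : ℤ)) ⊆
      (Finset.range p).filter (fun c : ℕ => ¬ ((p : ℤ) ∣ (f m).eval (c : ℤ))) :=
  Finset.monotone_filter_right _ fun _ _ h => h.1

/-- `#num + ω_m(p) ≤ ω_f(p)`: the removed classes and the roots of `f_m` are disjoint sets of roots
of `∏ fᵢ` modulo `p`. [folklore] -/
theorem card_num_add_card_roots_le (f : Fin k → ℤ[X]) (m : Fin k) (p : ℕ) :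
    #((Finset.range p).filter (fun c : ℕ => ¬ ((p : ℤ) ∣ (f m).eval (c : ℤ)) ∧ ∃ i, i ≠ m ∧ (p : ℤ)
      ∣ (f i).eval (c : ℤ))) +
      #((Finset.range p).filter (fun c : ℕ => (p : ℤ) ∣ (f m).eval (c : ℤ))) ≤
      polyRootCountMod f p := by
  rw [← Finset.card_union_of_disjoint]
  · unfold polyRootCountMod
    refine Finset.card_le_card fun c hc => ?_
    rw [Finset.mem_union, Finset.mem_filter, Finset.mem_filter] at hc
    rw [Finset.mem_filter]
    rcases hc with ⟨hc, -, i, -, hi⟩ | ⟨hc, hm⟩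
    · exact ⟨hc, hi.trans (Finset.dvd_prod_of_mem (fun j => (f j).eval (c : ℤ)) (mem_univ i))⟩
    · exact ⟨hc, hm.trans (Finset.dvd_prod_of_mem (fun j => (f j).eval (c : ℤ)) (mem_univ m))⟩
  · rw [Finset.disjoint_left]
    intro c hc hc'
    exact (Finset.mem_filter.mp hc).2.1 (Finset.mem_filter.mp hc').2

/-- `#den + ω_m(p) = p`: the classes with `p ∤ f_m` and the roots of `f_m` partition the residues.
[folklore] -/
theorem card_den_add_card_roots_eq (f : Fin k → ℤ[X]) (m : Fin k) (p : ℕ) :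
    #((Finset.range p).filter (fun c : ℕ => ¬ ((p : ℤ) ∣ (f m).eval (c : ℤ)))) +
      #((Finset.range p).filter (fun c : ℕ => (p : ℤ) ∣ (f m).eval (c : ℤ))) = p := by
  rw [add_comm, Finset.card_filter_add_card_filter_not, Finset.card_range]

/-- For a Bateman–Horn system, `ω_f(p) ≤ Σ deg fᵢ` at every prime (Lagrange for `∏ fᵢ mod p ≠ 0`,
the non-vanishing being `ω_f(p) < p`). [folklore] -/
theorem polyRootCountMod_le_sum_natDegree (hf : IsBatemanHornSystem f) {p : ℕ} (hp : p.Prime) :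
    polyRootCountMod f p ≤ ∑ i, (f i).natDegree := by
  have hlt := hf.hasNoFixedPrimeDivisor p hp
  rw [PolyPrimeCountBrun.polyRootCountMod_eq_single_prod] at hlt ⊢
  exact (PolyPrimeCountBrun.polyRootCountMod_single_le_natDegree_of_lt hp hlt).trans
    (natDegree_prod_le _ _)

/-- For a Bateman–Horn system the denominator of the conditional density is positive:
`#{c < p : p ∤ f_m(c)} > 0` (as `ω_m(p) ≤ ω_f(p) < p`). [folklore] -/
theorem card_den_pos (hf : IsBatemanHornSystem f) (m : Fin k) {p : ℕ} (hp : p.Prime) :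
    0 < #((Finset.range p).filter (fun c : ℕ => ¬ ((p : ℤ) ∣ (f m).eval (c : ℤ)))) := by
  have h1 := card_num_add_card_roots_le f m p
  have h2 := card_den_add_card_roots_eq f m p
  have h3 := hf.hasNoFixedPrimeDivisor p hp
  omega

/-- `0 ≤ g_m(p)`. [folklore] -/
theorem condDensity_nonneg (f : Fin k → ℤ[X]) (m : Fin k) (p : ℕ) :
    0 ≤ ((((Finset.range p).filter (fun c : ℕ => ¬ ((p : ℤ) ∣ (f m).eval (c : ℤ)) ∧ ∃ i, i ≠ m ∧
      (p : ℤ) ∣ (f i).eval (c : ℤ))).card : ℕ) : ℝ) / ((((Finset.range p).filter (fun c : ℕ =>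
      ¬ ((p : ℤ) ∣ (f m).eval (c : ℤ)))).card : ℕ) : ℝ) := by
  positivity

/-- **`g_m(p) ≤ ω_f(p)/p`** for a Bateman–Horn system: with `a = #num`, `b = #den`, `r = ω_f(p)`,
`s = ω_m(p)` one has `a + s ≤ r`, `b + s = p`, `a ≤ b`, whence `a p = a b + a s ≤ a b + b s ≤ b r`.
[folklore] -/
theorem condDensity_le_rootDensity (hf : IsBatemanHornSystem f) (m : Fin k) {p : ℕ}
    (hp : p.Prime) :
    ((((Finset.range p).filter (fun c : ℕ => ¬ ((p : ℤ) ∣ (f m).eval (c : ℤ)) ∧ ∃ i, i ≠ m ∧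
      (p : ℤ) ∣ (f i).eval (c : ℤ))).card : ℕ) : ℝ) / ((((Finset.range p).filter (fun c : ℕ =>
      ¬ ((p : ℤ) ∣ (f m).eval (c : ℤ)))).card : ℕ) : ℝ) ≤
      ((polyRootCountMod f p : ℕ) : ℝ) / p := by
  have h1 := card_num_add_card_roots_le f m p
  have h2 := card_den_add_card_roots_eq f m p
  have h4 := Finset.card_le_card (num_subset_den f m p)
  have hb := card_den_pos hf m hp
  set a := #((Finset.range p).filter (fun c : ℕ => ¬ ((p : ℤ) ∣ (f m).eval (c : ℤ)) ∧ ∃ i, i ≠ m ∧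
      (p : ℤ) ∣ (f i).eval (c : ℤ))) with ha
  set b := #((Finset.range p).filter (fun c : ℕ => ¬ ((p : ℤ) ∣ (f m).eval (c : ℤ)))) with hb'
  set s := #((Finset.range p).filter (fun c : ℕ => (p : ℤ) ∣ (f m).eval (c : ℤ))) with hs
  set r := polyRootCountMod f p with hr
  have hkey : a * p ≤ r * b := by
    calc a * p = a * b + a * s := by rw [← h2]; ring
      _ ≤ a * b + b * s := by gcongr
      _ = b * (a + s) := by ring
      _ ≤ b * r := Nat.mul_le_mul_left b h1
      _ = r * b := mul_comm _ _
  have hp0 : (0 : ℝ) < p := by exact_mod_cast hp.pos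
  have hb0 : (0 : ℝ) < b := by exact_mod_cast hb
  rw [div_le_div_iff₀ hb0 hp0]
  exact_mod_cast hkey

/-- **`g_m(p) < 1`** for a Bateman–Horn system (from `g_m(p) ≤ ω_f(p)/p` and `ω_f(p) < p`).
[folklore] -/
theorem condDensity_lt_one (hf : IsBatemanHornSystem f) (m : Fin k) {p : ℕ} (hp : p.Prime) :
    ((((Finset.range p).filter (fun c : ℕ => ¬ ((p : ℤ) ∣ (f m).eval (c : ℤ)) ∧ ∃ i, i ≠ m ∧
      (p : ℤ) ∣ (f i).eval (c : ℤ))).card : ℕ) : ℝ) / ((((Finset.range p).filter (fun c : ℕ =>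
      ¬ ((p : ℤ) ∣ (f m).eval (c : ℤ)))).card : ℕ) : ℝ) < 1 := by
  refine (condDensity_le_rootDensity hf m hp).trans_lt ?_
  have hp0 : (0 : ℝ) < p := by exact_mod_cast hp.pos
  rw [div_lt_one hp0]
  exact_mod_cast hf.hasNoFixedPrimeDivisor p hp

/-! ### The dimension of the conditional density and the size of the sieve factor -/

/-- **The conditional density has sieve dimension `2S`, `S = Σ deg fᵢ`.**  Every arithmetic function
`g` with `g(p) = g_m(p)` at the primes satisfies `Ω(2S)` with the constant
`K_S = (2S+1)^{2S+1} e^{2S(9/2 + 6/log 2)}` (domination `g_m(p) ≤ ω_f(p)/p` and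
`BoundedClassDensity.hasSieveDimension_of_card_le` for the root-count density, `ω_f(p) ≤ S`,
`ω_f(p) < p`). [folklore] -/
theorem hasSieveDimension_condDensity (hf : IsBatemanHornSystem f) (m : Fin k)
    {g : ArithmeticFunction ℝ}
    (hg : ∀ p : ℕ, p.Prime → g p = ((((Finset.range p).filter (fun c : ℕ => ¬ ((p : ℤ) ∣ (f
      m).eval (c : ℤ)) ∧ ∃ i, i ≠ m ∧ (p : ℤ) ∣ (f i).eval (c : ℤ))).card : ℕ) : ℝ) /
      ((((Finset.range p).filter (fun c : ℕ => ¬ ((p : ℤ) ∣ (f m).eval (c : ℤ)))).card : ℕ) : ℝ)) :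
    HasSieveDimension g (2 * ((∑ i, (f i).natDegree : ℕ) : ℝ))
      (((2 * (∑ i, (f i).natDegree) + 1 : ℕ) : ℝ) ^ (2 * (∑ i, (f i).natDegree) + 1) *
        Real.exp (2 * ((∑ i, (f i).natDegree : ℕ) : ℝ) * (9 / 2 + 6 / Real.log 2))) := by
  obtain ⟨g', hg'⟩ : ∃ g' : ArithmeticFunction ℝ,
      ∀ p : ℕ, p.Prime → g' p = ((polyRootCountMod f p : ℕ) : ℝ) / p :=
    ⟨⟨fun d => if d = 0 then 0 else ((polyRootCountMod f d : ℕ) : ℝ) / d, if_pos rfl⟩,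
      fun p hp => if_neg hp.ne_zero⟩
  have hdim := BoundedClassDensity.hasSieveDimension_of_card_le hg'
    (fun p hp => polyRootCountMod_le_sum_natDegree hf hp) (fun p hp => hf.hasNoFixedPrimeDivisor p hp)
  refine hasSieveDimension_of_apply_le hdim fun p hp => ?_
  rw [hg p hp, hg' p hp]
  exact ⟨condDensity_nonneg f m p, condDensity_le_rootDensity hf m hp⟩

/-- **The sieve factor is positive**: `W_m(M) = ∏_{p < M} (1 − g_m(p)) > 0`. [folklore] -/
theorem sieveFactor_pos (hf : IsBatemanHornSystem f) (m : Fin k) (M : ℕ) :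
    0 < ∏ p ∈ Nat.primesBelow M, (1 - ((((Finset.range p).filter (fun c : ℕ => ¬ ((p : ℤ) ∣ (f
      m).eval (c : ℤ)) ∧ ∃ i, i ≠ m ∧ (p : ℤ) ∣ (f i).eval (c : ℤ))).card : ℕ) : ℝ) /
      ((((Finset.range p).filter (fun c : ℕ => ¬ ((p : ℤ) ∣ (f m).eval (c : ℤ)))).card : ℕ) : ℝ)) :=
  Finset.prod_pos fun _ hp => sub_pos.mpr (condDensity_lt_one hf m (Nat.prime_of_mem_primesBelow hp))

/-- **Lower bound for the sieve factor**: there is `c = c(f) > 0` with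
`W_m(z) = ∏_{p < z} (1 − g_m(p)) ≥ c/(log z)^{2S}` for every `z ≥ 2`, `S = Σ deg fᵢ` (the case `w = 2`
of the dimension condition `hasSieveDimension_condDensity`). [folklore] -/
theorem exists_le_sieveFactor (hf : IsBatemanHornSystem f) (m : Fin k) :
    ∃ c : ℝ, 0 < c ∧ ∀ z : ℝ, 2 ≤ z →
      c / Real.log z ^ (2 * ((∑ i, (f i).natDegree : ℕ) : ℝ)) ≤
        ∏ p ∈ Nat.primesBelow ⌈z⌉₊, (1 - ((((Finset.range p).filter (fun c : ℕ => ¬ ((p : ℤ) ∣ (f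
          m).eval (c : ℤ)) ∧ ∃ i, i ≠ m ∧ (p : ℤ) ∣ (f i).eval (c : ℤ))).card : ℕ) : ℝ) /
          ((((Finset.range p).filter (fun c : ℕ => ¬ ((p : ℤ) ∣ (f m).eval (c : ℤ)))).card : ℕ) :
          ℝ)) := by
  obtain ⟨g, hg⟩ : ∃ g : ArithmeticFunction ℝ, ∀ p : ℕ, p.Prime → g p =
      ((((Finset.range p).filter (fun c : ℕ => ¬ ((p : ℤ) ∣ (f m).eval (c : ℤ)) ∧ ∃ i, i ≠ m ∧
        (p : ℤ) ∣ (f i).eval (c : ℤ))).card : ℕ) : ℝ) / ((((Finset.range p).filter (fun c : ℕ =>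
        ¬ ((p : ℤ) ∣ (f m).eval (c : ℤ)))).card : ℕ) : ℝ) :=
    ⟨⟨fun d => if d = 0 then 0 else ((((Finset.range d).filter (fun c : ℕ => ¬ ((d : ℤ) ∣ (f
        m).eval (c : ℤ)) ∧ ∃ i, i ≠ m ∧ (d : ℤ) ∣ (f i).eval (c : ℤ))).card : ℕ) : ℝ) /
        ((((Finset.range d).filter (fun c : ℕ => ¬ ((d : ℤ) ∣ (f m).eval (c : ℤ)))).card : ℕ) : ℝ),
      if_pos rfl⟩, fun p hp => if_neg hp.ne_zero⟩
  have hdim := hasSieveDimension_condDensity hf m hg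
  set κ : ℝ := 2 * ((∑ i, (f i).natDegree : ℕ) : ℝ) with hκ
  set K : ℝ := ((2 * (∑ i, (f i).natDegree) + 1 : ℕ) : ℝ) ^ (2 * (∑ i, (f i).natDegree) + 1) *
    Real.exp (2 * ((∑ i, (f i).natDegree : ℕ) : ℝ) * (9 / 2 + 6 / Real.log 2)) with hK
  have hK0 : 0 < K := lt_of_lt_of_le zero_lt_one hdim.one_le
  have hlog2 : 0 < Real.log 2 := Real.log_pos one_lt_two
  refine ⟨Real.log 2 ^ κ / K, by positivity, fun z hz => ?_⟩
  have h := le_prod_one_sub_of_hasSieveDimension hdim hz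
  have hprod : ∏ p ∈ Nat.primesBelow ⌈z⌉₊, (1 - g p) = ∏ p ∈ Nat.primesBelow ⌈z⌉₊, (1 -
      ((((Finset.range p).filter (fun c : ℕ => ¬ ((p : ℤ) ∣ (f m).eval (c : ℤ)) ∧ ∃ i, i ≠ m ∧
        (p : ℤ) ∣ (f i).eval (c : ℤ))).card : ℕ) : ℝ) / ((((Finset.range p).filter (fun c : ℕ =>
        ¬ ((p : ℤ) ∣ (f m).eval (c : ℤ)))).card : ℕ) : ℝ)) :=
    Finset.prod_congr rfl fun p hp => by rw [hg p (Nat.prime_of_mem_primesBelow hp)]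
  rw [hprod] at h
  refine le_trans (le_of_eq ?_) h
  rw [div_div]

end SieveDecouplingOdd

/-- **Registered sub-goal `stub_condDensityDimension` (helper obligation of stubs S'a/S'b, line
`birth`)**: for every Bateman–Horn system `f` and member `m`, every arithmetic function agreeing at
the primes with the conditional density `g_m` satisfies the sieve-dimension condition `Ω(2S)`,
`S = Σ deg fᵢ`, with the constant `K_S = (2S+1)^{2S+1} e^{2S(9/2 + 6/log 2)}`
(`SieveDecouplingOdd.hasSieveDimension_condDensity`, closed form). [folklore] -/
theorem stub_condDensityDimension :
    ∀ (k : ℕ) (f : Fin k → Polynomial ℤ), Literature.NumberTheory.Sieve.IsBatemanHornSystem f → ∀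
    (m : Fin k) (g : ArithmeticFunction ℝ), (∀ p : ℕ, p.Prime → g p = ((((Finset.range p).filter
    (fun c : ℕ => ¬ ((p : ℤ) ∣ (f m).eval (c : ℤ)) ∧ ∃ i, i ≠ m ∧ (p : ℤ) ∣ (f i).eval (c :
    ℤ))).card : ℕ) : ℝ) / ((((Finset.range p).filter (fun c : ℕ => ¬ ((p : ℤ) ∣ (f m).eval (c :
    ℤ)))).card : ℕ) : ℝ)) → Literature.NumberTheory.Sieve.HasSieveDimension g (2 * ((∑ i, (f
    i).natDegree : ℕ) : ℝ)) (((2 * (∑ i, (f i).natDegree) + 1 : ℕ) : ℝ) ^ (2 * (∑ i, (f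
    i).natDegree) + 1) * Real.exp (2 * ((∑ i, (f i).natDegree : ℕ) : ℝ) * (9 / 2 + 6 / Real.log
    2))) :=
  fun _ _ hf m _ hg => SieveDecouplingOdd.hasSieveDimension_condDensity hf m hg

end Summit.Parity.BatemanHorn.Cruxes.OddSectorShareLinear.Birth

end
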